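import Summits.QuantumFields.YangMills.Theorems.BalabanUVNodesN11CondExpOfFibrewiseIdentity

/-!
# DAG node N11 — THE (O3′) CLAUSE AT THE STAGE-13 LETTERS FROM ONE FROZEN-`y` FIBREWISE IDENTITY PER OLD BRANCH (all levels; the first 𝐓-step with the old piece `w(s′)·ρ₀`)

HEADER — WORK-UNIT METADATA.  Cell `pub-ymgap`, YM-PLAN Track A (D-0062), seat `pub-ymgap-dag-n11-d` (g17; N11 [B14], s2), route `BalabanUVNodes`, item K1⁹ = stmt-QuantumFields-27364
(helper lane, `--kind proof --supports 27364 --as helper`, count-neutral).  [I] = [Balaban1987RG1], [II] = [Balaban1988RG2Cluster], [III] = [Balaban1988Convergent].  The Stage-13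
editions of this seat's `…N11CondExpOfFibrewiseIdentity` (the FUBINI REDUCTION `condExp_identity_of_fibrewise_of_nonneg`): p646357's §2 ∕ §3
(`slotsTOfRecord₁₃H_succ_O3_of_hasSect2FormAtZS_of_weak_of_provisos`, `slotsTOfRecord₁₃H_one_O3_of_weakRho_of_provisos`) with the displayed WEAK identity (joint test functions of the
presented point `(y, v₂)`) REPLACED by the FROZEN-`y` FIBREWISE identity (test functions of the new coarse variables `v₂` alone, the retained fine configuration `y` a parameter).
Row discharges VERBATIM as in p646357 (`hG_at_record₁₃_of_provisos`, `zetaOfRecord_nonneg`, `wOfRecord_nonneg`, `(h.tstep p k hkK).measW`, `measurable_chiSeqOfRecord_of_localBg`,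
`integrable_oldBranch_pieces₁₃H_of_integrable_graph`, `WtOfRecord₁₃H_laws`, `measurable_intrinsicReading_of_hgm`, `hgm_at_record₁₃_of_rows`, `genDataOfRecord_laws`, `aOp_nonneg`,
`tkBranchOfRecord_nonneg`, `sect2Operand_pos`), then p639540 ∕ p640513 by name.

WHY THIS FILE.  Print's §3 computation ([III] (3.10)–(3.25) pp.267–270; at the first step [I] §2 p.267 + [II]) is FIBREWISE: the level-`k` variables over `Ω^c_{k+1}` are frozen
(`y`), the variables over `Ω_{k+1}` are integrated against `∏_c δ(V(c)Ū(c)⁻¹)`, and the result is read as a density in the new variables `V|_{B_{k+1}(Ω_{k+1})}` (`v₂`) with `y` a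
parameter.  So the honest shape of the (O3′) debt of a §3 supplier is, per 𝐓-present child `s′` and old branch `S₀`:
  (hfib)  for (⊗_{b ∈ B_k(Ω^c_{k+1})} dU(b))-a.e. `y` and every bounded measurable `h` of `v₂`:
          ∫ piece_{S₀}(e⁻¹(y,u)) · h(c ↦ Ū(e⁻¹(y,u))(c)) (⊗_{b ∉ B_k(Ω^c_{k+1})} dU(b))(u) = ∫ R̃_{S₀}(y,v₂) · h(v₂) (⊗_{c ∉ B_{k+1}(Ω^c_{k+1})} dV(c))(v₂),
`piece_{S₀} = w(s′)·χ_k(init s′)·(𝐓_k(init s′,S₀)[W₀] e^{A_k(init s′,S₀)})(base_k ·)`, `R̃_{S₀}` = 11a's ζ-weighted new `Y`-sum read at the presented point (p638596's intrinsic reading).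

WHAT THIS FILE PROVES (0 `def`, 0 `sorry`, standard axioms).  §1 ★★★ `slotsTOfRecord₁₃H_succ_O3_of_hasSect2FormAtZS_of_fibrewise_of_provisos` (Stage 13, every level `k < K`: the (O3′)
disjunction from Theorem 1's level-`k` form `HasSect2FormAtZS`, the core provisos `θ.Provisos₁₃CoPH`, the residual ∕ operand measurability rows, and ONE frozen-`y` identity per old branch).
§2 ★★★ `slotsTOfRecord₁₃H_one_O3_of_fibrewiseRho_of_provisos` (the first 𝐓-step: base form discharged, old piece `w(s′)·ρ₀`, ONE frozen-`y` identity — [I] Thm 1 + [II] read fibrewise).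

HONEST FRAMING.  Helper lane of K1⁹; count-neutral; two compositions BY NAME over this seat's Fubini reduction; (hfib) DISPLAYED — it IS [I] §2's change of variables on the fibre +
Jacobian + gauge fixing ([15]) + the conditional Gaussian normalisation `ζ` + [III] Thm 2's re-expansion, NOT proved; NO chart, NO Jacobian, NO Gaussian integration performed here; nothing
of Bałaban asserted; N11 NOT discharged; K1⁹ NOT closed, no registered stub touched; counts unmoved (typed 28∕28 · discharged 5∕27 · A 5∕28).  One finite `𝕋⁴_{L^K}` programme at fixed
`ε = L^{−K}` — NOT ℝ⁴, NOT OS, NOT a mass gap, NOT Clay.  No `sorry`, `axiom`, `def`, `instance`, `notation`.  Sources (SHAPE only): [III] Thm 1 p.262, Thm 2 p.263, (2.18) p.257,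
(2.20)–(2.21) p.258, (3.1) p.264, (3.10)–(3.14) p.267, (3.23)–(3.25) p.270, §3 p.279; [I] Thm 1 p.258, (0.4) p.253, §2 p.267.
-/

noncomputable section

open MeasureTheory ProbabilityTheory
open scoped ENNReal NNReal BigOperators Matrix.Norms.L2Operator

namespace Summit.QuantumFields.YangMills.Theorems.BalabanUVNodesN11O3OfFibrewiseIdentityAtRecord13

open Literature.MathematicalPhysics.QuantumFieldTheory.Balaban1983to89
open Literature.MathematicalPhysics.QuantumFieldTheory.Balaban1983to89.T4AveragingDisintegration
open BalabanUVNodesN11CondExpOfFibrewiseIdentity (condExp_identity_of_fibrewise_of_nonneg)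
open BalabanUVNodesN11O3OfIntrinsicReading (measurable_intrinsicReading_of_hgm)
open BalabanUVNodesN11O3OfIntrinsicReadingAtRecord13 (slotsTOfRecord₁₃H_succ_O3_of_hasSect2FormAtZS_of_oldBranchCondExp_of_provisos)
open BalabanUVNodesN11FirstTStepO3OfIntrinsicReading (slotsTOfRecord₁₃H_one_O3_of_condExpRho_of_provisos)
open BalabanUVNodesN11TStepGraphIntegrableOfProvisos (hG_at_record₁₃_of_provisos)
open BalabanUVNodesN11TStepOldBranchGraphIntegrable (integrable_oldBranch_pieces₁₃H_of_integrable_graph tkBranchOfRecord_nonneg)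
open BalabanUVNodesN11TStepBranchSumAtRecord13OfLaws (hgm_at_record₁₃_of_rows)
open N21StepWeightsPositivity (zetaOfRecord_nonneg)
open Literature.MathematicalPhysics.QuantumFieldTheory.Balaban1983to89.B14SeparationOfRecord (slotsTOfRecord_succ_eq_zero_of_init_eq_zero)
open Node00 hiding SU
open Node00.Tk T4Continuum B14.Eq218Concrete
open B10Eq42TorusConstraint (bondsIn)

variable {F : T4Family} {N : ℕ} [NeZero N]

/-! ## §1  Stage-13 letters at the core provisos: the (O3′) disjunction from ONE FROZEN-`y` FIBREWISE IDENTITY per old branch -/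

section Stage13
/-- ★★★ **THE (O3′) DISJUNCTION OF `PresentChildObligations` FROM THEOREM 1's LEVEL-`k` FORM, THE CORE PROVISOS, ROWS, AND ONE FROZEN-`y` FIBREWISE IDENTITY PER OLD BRANCH** —
p646357 §2 with the weak identity produced by the Fubini reduction `condExp_identity_of_fibrewise_of_nonneg` (`R̃_{S₀} ≥ 0`, measurable, the piece `dU`-integrable: theorems of the
provisos as there).  The displayed identity: for a.e. frozen `y = U|_{B_k(Ω^c_{k+1})}` and every bounded measurable `h` of the new variables `v₂` alone,
`∫ piece_{S₀}(e⁻¹(y,u))·h(Ū(e⁻¹(y,u))|_{new}) du = ∫ R̃_{S₀}(y,v₂)·h(v₂) dv₂`. [cite: Balaban1988Convergent, Thm 1 p.262, Thm 2 p.263, §3 p.279, (3.1) p.264, (3.10)–(3.14) p.267, (3.23)–(3.25) p.270; Balaban1987RG1, (0.4) p.253, §2 p.267] -/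
theorem slotsTOfRecord₁₃H_succ_O3_of_hasSect2FormAtZS_of_fibrewise_of_provisos (θ : Stage13HParams F N) (h : θ.Provisos₁₃CoPH F N)
    (p : B12.RunParams) {k : ℕ} (hkK : k < p.K)
    {hdec : DecidableEq (PBond (F.P p.K) k)} {hdec' : DecidableEq (PBond (F.P p.K) (k + 1))} (hk : k + 1 ≤ (F.P p.K).m + (F.P p.K).K)
    (s' : SeqOfRecord F θ.ν θ.τ9.M (gOfRecord₁₃ F N θ.toStage13Params p) p.K (k + 1))
    {law : SeqOfRecord F θ.ν θ.τ9.M (gOfRecord₁₃ F N θ.toStage13Params p) p.K k → Sect2.TermValues (F.P p.K) (MatA N) (FluctV N) θ.τ9.M → Prop}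
    {t : SeqOfRecord F θ.ν θ.τ9.M (gOfRecord₁₃ F N θ.toStage13Params p) p.K k → Sect2.TermValues (F.P p.K) (MatA N) (FluctV N) θ.τ9.M}
    {Ek : SeqOfRecord F θ.ν θ.τ9.M (gOfRecord₁₃ F N θ.toStage13Params p) p.K k → ℝ}
    (hform : HasSect2FormAtZS F N (FluctV N) p.K (settingOfRecord₁₃ F N θ.toStage13Params p) k (θ.rzAt p) (WtOfRecord₁₃H F N θ p)
      (UbgOfRecord₁₃CoP F N θ.toStage13Params p k) law
      (slotsOfRecord F N θ.ν θ.τ9 (EOfRecord₁₃ F N θ.toStage13Params) (wOfRecord₉ F N θ.toStage9Params) θ.ppSel p (gOfRecord₁₃ F N θ.toStage13Params p) k) t Ek)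
    (t' : Sect2.TermValues (F.P p.K) (MatA N) (FluctV N) θ.τ9.M) (E' : ℝ)
    (hζ0m : ∀ j Y, Measurable ((θ.zhAt p s'.init).ζ0 j Y)) (hqm : ∀ j Λ', Measurable ((θ.zhAt p s'.init).quad j Λ'))
    (hΦ₀m : ∀ S₀ ∈ admSOfRecord F θ.ν θ.τ9.M (gOfRecord₁₃ F N θ.toStage13Params p) p.K k s'.init,
      Measurable fun ω : MultiCfg (F.P p.K) (SU N) (FluctV N) =>
        (sect2Operand F N (FluctV N) p.K (settingOfRecord₁₃ F N θ.toStage13Params p) (θ.rzAt p s'.init) s'.init (t s'.init) (Ek s'.init)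
            (UbgOfRecord₁₃CoP F N θ.toStage13Params p k s'.init)) (S₀, fun j => (ω j).2) (fun j => (ω j).1))
    (hζm : ∀ j Y, Measurable ((θ.zhAt p s').ζ0 j Y)) (hqm' : ∀ j Λ', Measurable ((θ.zhAt p s').quad j Λ'))
    (hΦm : ∀ S ∈ admSOfRecord F θ.ν θ.τ9.M (gOfRecord₁₃ F N θ.toStage13Params p) p.K (k + 1) s',
      Measurable fun ω : MultiCfg (F.P p.K) (SU N) (FluctV N) =>
        (sect2Operand F N (FluctV N) p.K (settingOfRecord₁₃ F N θ.toStage13Params p) (θ.rzAt p s') s' t' E'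
                  (UbgOfRecord₁₃CoP F N θ.toStage13Params p (k + 1) s')) (S, fun j => (ω j).2) (fun j => (ω j).1))
    -- ONE FROZEN-`y` FIBREWISE IDENTITY PER OLD BRANCH
    (hfib : ∀ S₀ ∈ admSOfRecord F θ.ν θ.τ9.M (gOfRecord₁₃ F N θ.toStage13Params p) p.K k s'.init,
      ∀ᵐ y ∂(Measure.pi fun _ : ↥(Set.toFinite (bondsIn k (s'.Ω (k + 1))ᶜ)).toFinset => (HaarData.haar : Measure (SU N))),
      ∀ h : ({c : PBond (F.P p.K) (k + 1) // c ∉ (Set.toFinite (bondsIn (k + 1) (s'.Ω (k + 1))ᶜ)).toFinset} → SU N) → ℝ, Measurable h → (∃ C : ℝ, ∀ v, |h v| ≤ C) →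
      ∫ u, (fun U => wOfRecord₉ F N θ.toStage9Params p (gOfRecord₁₃ F N θ.toStage13Params p) k s' U ((avOfRecord F N p.K k).avg U) *
        (chiSeqOfRecord F N θ.ν θ.τ9.M (gOfRecord₁₃ F N θ.toStage13Params p) p.K k s'.init U *
          tkBranchOfRecord F N (FluctV N) θ.ν θ.τ9.M (gOfRecord₁₃ F N θ.toStage13Params p) p.K (WtOfRecord₁₃H F N θ p s'.init) s'.init S₀ k (fun ω => (sect2Operand F N (FluctV N) p.K (settingOfRecord₁₃ F N θ.toStage13Params p) (θ.rzAt p s'.init) s'.init (t s'.init) (Ek s'.init)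
            (UbgOfRecord₁₃CoP F N θ.toStage13Params p k s'.init)) (S₀, fun j => (ω j).2) (fun j => (ω j).1)) (baseCfg k U)))
          ((MeasurableEquiv.piEquivPiSubtypeProd (fun _ : PBond (F.P p.K) k => SU N)
              (· ∈ (Set.toFinite (bondsIn k (s'.Ω (k + 1))ᶜ)).toFinset)).symm (y, u)) *
        h (fun c : {c : PBond (F.P p.K) (k + 1) // c ∉ (Set.toFinite (bondsIn (k + 1) (s'.Ω (k + 1))ᶜ)).toFinset} =>
          (avOfRecord F N p.K k).avg ((MeasurableEquiv.piEquivPiSubtypeProd (fun _ : PBond (F.P p.K) k => SU N)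
              (· ∈ (Set.toFinite (bondsIn k (s'.Ω (k + 1))ᶜ)).toFinset)).symm (y, u)) c)
        ∂(Measure.pi fun _ : {b : PBond (F.P p.K) k // b ∉ (Set.toFinite (bondsIn k (s'.Ω (k + 1))ᶜ)).toFinset} => (HaarData.haar : Measure (SU N))) =
        ∫ v, (∑ Y ∈ (Set.toFinite {Y : Set (Site (F.P p.K) 0) | Y ∈ SClassOfRecord F θ.ν (gOfRecord₁₃ F N θ.toStage13Params p) p.K (k + 1) ∧ Y ⊆ s'.Ω (k + 1) ∩ (s'.Λ (k + 1))ᶜ}).toFinset,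
          zetaOp (genDataOfRecord F N (FluctV N) θ.ν θ.τ9.M (gOfRecord₁₃ F N θ.toStage13Params p) p.K (WtOfRecord₁₃H F N θ p s') s' (Function.update S₀ (k + 1) Y) k).ζ
            (aOp k (genDataOfRecord F N (FluctV N) θ.ν θ.τ9.M (gOfRecord₁₃ F N θ.toStage13Params p) p.K (WtOfRecord₁₃H F N θ p s') s' (Function.update S₀ (k + 1) Y) k).sA
              (genDataOfRecord F N (FluctV N) θ.ν θ.τ9.M (gOfRecord₁₃ F N θ.toStage13Params p) p.K (WtOfRecord₁₃H F N θ p s') s' (Function.update S₀ (k + 1) Y) k).w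
              (tkBranchOfRecord F N (FluctV N) θ.ν θ.τ9.M (gOfRecord₁₃ F N θ.toStage13Params p) p.K (WtOfRecord₁₃H F N θ p s') s'.init S₀ k
                (fun ω => (sect2Operand F N (FluctV N) p.K (settingOfRecord₁₃ F N θ.toStage13Params p) (θ.rzAt p s') s' t' E'
                  (UbgOfRecord₁₃CoP F N θ.toStage13Params p (k + 1) s')) (Function.update S₀ (k + 1) Y, fun j => (ω j).2) (fun j => (ω j).1))))
            (Function.update (baseCfg (k + 1) ((MeasurableEquiv.piEquivPiSubtypeProd (fun _ : PBond (F.P p.K) (k + 1) => SU N)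
              (· ∈ (Set.toFinite (bondsIn (k + 1) (s'.Ω (k + 1))ᶜ)).toFinset)).symm (avgRestrOfRecord F N p.K k (Set.toFinite (bondsIn k (s'.Ω (k + 1))ᶜ)).toFinset
                (Set.toFinite (bondsIn (k + 1) (s'.Ω (k + 1))ᶜ)).toFinset y, v))) k
            (Function.updateFinset ((baseCfg (V := FluctV N) (k + 1) ((MeasurableEquiv.piEquivPiSubtypeProd (fun _ : PBond (F.P p.K) (k + 1) => SU N)
              (· ∈ (Set.toFinite (bondsIn (k + 1) (s'.Ω (k + 1))ᶜ)).toFinset)).symm (avgRestrOfRecord F N p.K k (Set.toFinite (bondsIn k (s'.Ω (k + 1))ᶜ)).toFinset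
                (Set.toFinite (bondsIn (k + 1) (s'.Ω (k + 1))ᶜ)).toFinset y, v))) k).1 (Set.toFinite (bondsIn k (s'.Ω (k + 1))ᶜ)).toFinset y,
              ((baseCfg (V := FluctV N) (k + 1) ((MeasurableEquiv.piEquivPiSubtypeProd (fun _ : PBond (F.P p.K) (k + 1) => SU N)
              (· ∈ (Set.toFinite (bondsIn (k + 1) (s'.Ω (k + 1))ᶜ)).toFinset)).symm (avgRestrOfRecord F N p.K k (Set.toFinite (bondsIn k (s'.Ω (k + 1))ᶜ)).toFinset
                (Set.toFinite (bondsIn (k + 1) (s'.Ω (k + 1))ᶜ)).toFinset y, v))) k).2))) * h v ∂(Measure.pi fun _ : {c : PBond (F.P p.K) (k + 1) // c ∉ (Set.toFinite (bondsIn (k + 1) (s'.Ω (k + 1))ᶜ)).toFinset} =>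
            (HaarData.haar : Measure (SU N)))) :
    slotsTOfRecord F N θ.ν θ.τ9 (EOfRecord₁₃ F N θ.toStage13Params) (wOfRecord₉ F N θ.toStage9Params) θ.ppSel p (gOfRecord₁₃ F N θ.toStage13Params p) (k + 1) s' = 0 ∨
      ∀ᵐ V' ∂fieldMeasure (F.P p.K) (k + 1) (SU N),
        chiSeqOfRecord F N θ.ν θ.τ9.M (gOfRecord₁₃ F N θ.toStage13Params p) p.K (k + 1) s' V' ≠ 0 →
          slotsTOfRecord F N θ.ν θ.τ9 (EOfRecord₁₃ F N θ.toStage13Params) (wOfRecord₉ F N θ.toStage9Params) θ.ppSel p (gOfRecord₁₃ F N θ.toStage13Params p) (k + 1) s' V' =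
            sect2Slot F N (FluctV N) p.K (settingOfRecord₁₃ F N θ.toStage13Params p) (θ.rzAt p s') (WtOfRecord₁₃H F N θ p s') s' t' E'
              (UbgOfRecord₁₃CoP F N θ.toStage13Params p (k + 1) s') V' := by
  rcases (hform.2 s'.init).2 with h0 | hae
  · exact Or.inl (slotsTOfRecord_succ_eq_zero_of_init_eq_zero F N θ.ν θ.τ9 _ _ θ.ppSel p _ _ s' h0)
  -- the piece's rows are theorems of the core provisos
  have hG := hG_at_record₁₃_of_provisos θ h p hkK s'
  have hζ0 := zetaOfRecord_nonneg F N θ.ν θ.τ9.M h.zetaUnity h.zetaAbs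
  have hw0 : ∀ U, 0 ≤ wOfRecord₉ F N θ.toStage9Params p (gOfRecord₁₃ F N θ.toStage13Params p) k s' U ((avOfRecord F N p.K k).avg U) :=
    fun U => wOfRecord_nonneg F N θ.ν θ.τ9.M p _ k θ.A₁ hζ0 s' U _
  have hgr : Measurable fun U : GaugeField (F.P p.K) k (SU N) => ((avOfRecord F N p.K k).avg U, U) :=
    (avOfRecord_measurable F N p.K k).prodMk measurable_id
  have hwm : Measurable fun U => wOfRecord₉ F N θ.toStage9Params p (gOfRecord₁₃ F N θ.toStage13Params p) k s' U ((avOfRecord F N p.K k).avg U) := by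
    have h' := ((h.tstep p k hkK).measW s').comp hgr
    exact h'
  have hχm : Measurable fun U => chiSeqOfRecord F N θ.ν θ.τ9.M (gOfRecord₁₃ F N θ.toStage13Params p) p.K k s'.init U :=
    measurable_chiSeqOfRecord_of_localBg (localBgMeasurable F N θ.ν) θ.τ9.M _ p.K k s'.init
  have hG₀ := integrable_oldBranch_pieces₁₃H_of_integrable_graph θ p s' t Ek hG hae h.zhLaws hw0 hwm hχm hζ0m hqm hΦ₀m
  -- the intrinsic reading is measurable and nonnegative
  have hW := WtOfRecord₁₃H_laws h.zhLaws p s'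
  have hRm := fun S₀ (h₀ : S₀ ∈ admSOfRecord F θ.ν θ.τ9.M (gOfRecord₁₃ F N θ.toStage13Params p) p.K k s'.init) =>
    measurable_intrinsicReading_of_hgm θ.ν θ.τ9.M (gOfRecord₁₃ F N θ.toStage13Params p) p (hdec := hdec) (hdec' := hdec') s' (WtOfRecord₁₃H F N θ p s')
      (sect2Operand F N (FluctV N) p.K (settingOfRecord₁₃ F N θ.toStage13Params p) (θ.rzAt p s') s' t' E'
                  (UbgOfRecord₁₃CoP F N θ.toStage13Params p (k + 1) s')) (hgm_at_record₁₃_of_rows θ p (hdec := hdec) (hdec' := hdec') s' t' E' hζm hqm' hΦm) S₀ h₀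
  have hR0 : ∀ (S₀ : ℕ → Set (Site (F.P p.K) 0)) (z : ((↥(Set.toFinite (bondsIn k (s'.Ω (k + 1))ᶜ)).toFinset → SU N) × ({c : PBond (F.P p.K) (k + 1) // c ∉ (Set.toFinite (bondsIn (k + 1) (s'.Ω (k + 1))ᶜ)).toFinset} → SU N))), 0 ≤ ∑ Y ∈ (Set.toFinite {Y : Set (Site (F.P p.K) 0) | Y ∈ SClassOfRecord F θ.ν (gOfRecord₁₃ F N θ.toStage13Params p) p.K (k + 1) ∧ Y ⊆ s'.Ω (k + 1) ∩ (s'.Λ (k + 1))ᶜ}).toFinset,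
            zetaOp (genDataOfRecord F N (FluctV N) θ.ν θ.τ9.M (gOfRecord₁₃ F N θ.toStage13Params p) p.K (WtOfRecord₁₃H F N θ p s') s' (Function.update S₀ (k + 1) Y) k).ζ
              (aOp k (genDataOfRecord F N (FluctV N) θ.ν θ.τ9.M (gOfRecord₁₃ F N θ.toStage13Params p) p.K (WtOfRecord₁₃H F N θ p s') s' (Function.update S₀ (k + 1) Y) k).sA
                (genDataOfRecord F N (FluctV N) θ.ν θ.τ9.M (gOfRecord₁₃ F N θ.toStage13Params p) p.K (WtOfRecord₁₃H F N θ p s') s' (Function.update S₀ (k + 1) Y) k).w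
                (tkBranchOfRecord F N (FluctV N) θ.ν θ.τ9.M (gOfRecord₁₃ F N θ.toStage13Params p) p.K (WtOfRecord₁₃H F N θ p s') s'.init S₀ k
                  (fun ω => (sect2Operand F N (FluctV N) p.K (settingOfRecord₁₃ F N θ.toStage13Params p) (θ.rzAt p s') s' t' E'
                    (UbgOfRecord₁₃CoP F N θ.toStage13Params p (k + 1) s')) (Function.update S₀ (k + 1) Y, fun j => (ω j).2) (fun j => (ω j).1))))
              (Function.update (baseCfg (k + 1) ((MeasurableEquiv.piEquivPiSubtypeProd (fun _ : PBond (F.P p.K) (k + 1) => SU N)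
                (· ∈ (Set.toFinite (bondsIn (k + 1) (s'.Ω (k + 1))ᶜ)).toFinset)).symm (avgRestrOfRecord F N p.K k (Set.toFinite (bondsIn k (s'.Ω (k + 1))ᶜ)).toFinset
                  (Set.toFinite (bondsIn (k + 1) (s'.Ω (k + 1))ᶜ)).toFinset z.1, z.2))) k
              (Function.updateFinset ((baseCfg (V := FluctV N) (k + 1) ((MeasurableEquiv.piEquivPiSubtypeProd (fun _ : PBond (F.P p.K) (k + 1) => SU N)
                (· ∈ (Set.toFinite (bondsIn (k + 1) (s'.Ω (k + 1))ᶜ)).toFinset)).symm (avgRestrOfRecord F N p.K k (Set.toFinite (bondsIn k (s'.Ω (k + 1))ᶜ)).toFinset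
                  (Set.toFinite (bondsIn (k + 1) (s'.Ω (k + 1))ᶜ)).toFinset z.1, z.2))) k).1 (Set.toFinite (bondsIn k (s'.Ω (k + 1))ᶜ)).toFinset z.1,
                ((baseCfg (V := FluctV N) (k + 1) ((MeasurableEquiv.piEquivPiSubtypeProd (fun _ : PBond (F.P p.K) (k + 1) => SU N)
                (· ∈ (Set.toFinite (bondsIn (k + 1) (s'.Ω (k + 1))ᶜ)).toFinset)).symm (avgRestrOfRecord F N p.K k (Set.toFinite (bondsIn k (s'.Ω (k + 1))ᶜ)).toFinset
                  (Set.toFinite (bondsIn (k + 1) (s'.Ω (k + 1))ᶜ)).toFinset z.1, z.2))) k).2)) := fun S₀ z =>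
    Finset.sum_nonneg fun Y _ => by
      rw [zetaOp_apply]
      exact mul_nonneg ((genDataOfRecord_laws F N (FluctV N) θ.ν θ.τ9.M (gOfRecord₁₃ F N θ.toStage13Params p) p.K hW s' (Function.update S₀ (k + 1) Y) k).zeta_nonneg _)
        (aOp_nonneg k _ (genDataOfRecord_laws F N (FluctV N) θ.ν θ.τ9.M (gOfRecord₁₃ F N θ.toStage13Params p) p.K hW s' (Function.update S₀ (k + 1) Y) k).w_nonneg
          (tkBranchOfRecord_nonneg θ.ν θ.τ9.M (gOfRecord₁₃ F N θ.toStage13Params p) p.K hW s'.init S₀ k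
            (fun ω => (sect2Operand_pos p.K _ _ s' t' E' _ (Function.update S₀ (k + 1) Y, fun j => (ω j).2) (fun j => (ω j).1)).le)) _)
  exact slotsTOfRecord₁₃H_succ_O3_of_hasSect2FormAtZS_of_oldBranchCondExp_of_provisos θ h p hkK (hdec := hdec) (hdec' := hdec') hk s' hform t' E'
    hζ0m hqm hΦ₀m hζm hqm' hΦm fun S₀ h₀ =>
      condExp_identity_of_fibrewise_of_nonneg θ.ν θ.τ9.M (gOfRecord₁₃ F N θ.toStage13Params p) p (hdec := hdec) (hdec' := hdec') hk s' (hG₀ S₀ h₀) (hR0 S₀) (hRm S₀ h₀) (hfib S₀ h₀)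

end Stage13

/-! ## §2  The first 𝐓-step: ONE frozen-`y` fibrewise identity with the old piece `w(s′)·ρ₀` -/

section FirstStep

/-- ★★★ **THE FIRST 𝐓-STEP's (O3′) DISJUNCTION FROM ONE FROZEN-`y` FIBREWISE IDENTITY** (old piece `w(s′)·ρ₀`, Theorem 1's base form discharged): p646357 §3 with the weak identity
produced by the Fubini reduction — for a.e. frozen `y = U|_{B_0(Ω^c_1)}` and every bounded measurable `h` of `V|_{B_1(Ω_1)}`:
`∫ w(s′)(U,Ū)·ρ₀(U)·h(Ū|_{B_1(Ω_1)}) dU|_{B_0(Ω_1)} = ∫ R̃_∅(y,v₂)·h(v₂) dv₂` at `U = e⁻¹(y,u)` — [I] Thm 1 + [II] read FIBREWISE: the old variables off the large-field region frozen, the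
small-field variables integrated against the averaging constraint. [cite: Balaban1988Convergent, Thm 1 p.262, (3.1) p.264, (3.23)–(3.25) p.270; Balaban1987RG1, Thm 1 p.258, §2 p.267] -/
theorem slotsTOfRecord₁₃H_one_O3_of_fibrewiseRho_of_provisos (θ : Stage13HParams F N) (h : θ.Provisos₁₃CoPH F N) (p : B12.RunParams) (hK : 0 < p.K)
    {hdec : DecidableEq (PBond (F.P p.K) 0)} {hdec' : DecidableEq (PBond (F.P p.K) 1)}
    (s' : SeqOfRecord F θ.ν θ.τ9.M (gOfRecord₁₃ F N θ.toStage13Params p) p.K 1)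
    (u₁ : Sect2.TermValues (F.P p.K) (MatA N) (FluctV N) θ.τ9.M) (e₁ : ℝ)
    (hζ0m : ∀ j Y, Measurable ((θ.zhAt p s'.init).ζ0 j Y)) (hqm : ∀ j Λ', Measurable ((θ.zhAt p s'.init).quad j Λ'))
    (hζm : ∀ j Y, Measurable ((θ.zhAt p s').ζ0 j Y)) (hqm' : ∀ j Λ', Measurable ((θ.zhAt p s').quad j Λ'))
    (hΦm : ∀ S ∈ admSOfRecord F θ.ν θ.τ9.M (gOfRecord₁₃ F N θ.toStage13Params p) p.K 1 s',
      Measurable fun ω : MultiCfg (F.P p.K) (SU N) (FluctV N) =>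
        (sect2Operand F N (FluctV N) p.K (settingOfRecord₁₃ F N θ.toStage13Params p) (θ.rzAt p s') s' u₁ e₁
                  (UbgOfRecord₁₃CoP F N θ.toStage13Params p 1 s')) (S, fun j => (ω j).2) (fun j => (ω j).1))
    -- ONE FROZEN-`y` FIBREWISE IDENTITY
    (hfib : ∀ᵐ y ∂(Measure.pi fun _ : ↥(Set.toFinite (bondsIn 0 (s'.Ω 1)ᶜ)).toFinset => (HaarData.haar : Measure (SU N))),
      ∀ h : ({c : PBond (F.P p.K) 1 // c ∉ (Set.toFinite (bondsIn 1 (s'.Ω 1)ᶜ)).toFinset} → SU N) → ℝ, Measurable h → (∃ C : ℝ, ∀ v, |h v| ≤ C) →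
      ∫ u, (fun U => wOfRecord₉ F N θ.toStage9Params p (gOfRecord₁₃ F N θ.toStage13Params p) 0 s' U ((avOfRecord F N p.K 0).avg U) *
            slotsOfRecord F N θ.ν θ.τ9 (EOfRecord₁₃ F N θ.toStage13Params) (wOfRecord₉ F N θ.toStage9Params) θ.ppSel p (gOfRecord₁₃ F N θ.toStage13Params p) 0 s'.init U)
          ((MeasurableEquiv.piEquivPiSubtypeProd (fun _ : PBond (F.P p.K) 0 => SU N)
              (· ∈ (Set.toFinite (bondsIn 0 (s'.Ω 1)ᶜ)).toFinset)).symm (y, u)) *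
        h (fun c : {c : PBond (F.P p.K) 1 // c ∉ (Set.toFinite (bondsIn 1 (s'.Ω 1)ᶜ)).toFinset} =>
          (avOfRecord F N p.K 0).avg ((MeasurableEquiv.piEquivPiSubtypeProd (fun _ : PBond (F.P p.K) 0 => SU N)
              (· ∈ (Set.toFinite (bondsIn 0 (s'.Ω 1)ᶜ)).toFinset)).symm (y, u)) c)
        ∂(Measure.pi fun _ : {b : PBond (F.P p.K) 0 // b ∉ (Set.toFinite (bondsIn 0 (s'.Ω 1)ᶜ)).toFinset} => (HaarData.haar : Measure (SU N))) =
        ∫ v, (∑ Y ∈ (Set.toFinite {Y : Set (Site (F.P p.K) 0) | Y ∈ SClassOfRecord F θ.ν (gOfRecord₁₃ F N θ.toStage13Params p) p.K 1 ∧ Y ⊆ s'.Ω 1 ∩ (s'.Λ 1)ᶜ}).toFinset,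
          zetaOp (genDataOfRecord F N (FluctV N) θ.ν θ.τ9.M (gOfRecord₁₃ F N θ.toStage13Params p) p.K (WtOfRecord₁₃H F N θ p s') s' (Function.update (fun _ => ∅) 1 Y) 0).ζ
            (aOp 0 (genDataOfRecord F N (FluctV N) θ.ν θ.τ9.M (gOfRecord₁₃ F N θ.toStage13Params p) p.K (WtOfRecord₁₃H F N θ p s') s' (Function.update (fun _ => ∅) 1 Y) 0).sA
              (genDataOfRecord F N (FluctV N) θ.ν θ.τ9.M (gOfRecord₁₃ F N θ.toStage13Params p) p.K (WtOfRecord₁₃H F N θ p s') s' (Function.update (fun _ => ∅) 1 Y) 0).w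
              (fun ω => (sect2Operand F N (FluctV N) p.K (settingOfRecord₁₃ F N θ.toStage13Params p) (θ.rzAt p s') s' u₁ e₁
                  (UbgOfRecord₁₃CoP F N θ.toStage13Params p 1 s')) (Function.update (fun _ => ∅) 1 Y, fun j => (ω j).2) (fun j => (ω j).1)))
            (Function.update (baseCfg 1 ((MeasurableEquiv.piEquivPiSubtypeProd (fun _ : PBond (F.P p.K) 1 => SU N)
              (· ∈ (Set.toFinite (bondsIn 1 (s'.Ω 1)ᶜ)).toFinset)).symm (avgRestrOfRecord F N p.K 0 (Set.toFinite (bondsIn 0 (s'.Ω 1)ᶜ)).toFinset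
                (Set.toFinite (bondsIn 1 (s'.Ω 1)ᶜ)).toFinset y, v))) 0
            (Function.updateFinset ((baseCfg (V := FluctV N) 1 ((MeasurableEquiv.piEquivPiSubtypeProd (fun _ : PBond (F.P p.K) 1 => SU N)
              (· ∈ (Set.toFinite (bondsIn 1 (s'.Ω 1)ᶜ)).toFinset)).symm (avgRestrOfRecord F N p.K 0 (Set.toFinite (bondsIn 0 (s'.Ω 1)ᶜ)).toFinset
                (Set.toFinite (bondsIn 1 (s'.Ω 1)ᶜ)).toFinset y, v))) 0).1 (Set.toFinite (bondsIn 0 (s'.Ω 1)ᶜ)).toFinset y,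
              ((baseCfg (V := FluctV N) 1 ((MeasurableEquiv.piEquivPiSubtypeProd (fun _ : PBond (F.P p.K) 1 => SU N)
              (· ∈ (Set.toFinite (bondsIn 1 (s'.Ω 1)ᶜ)).toFinset)).symm (avgRestrOfRecord F N p.K 0 (Set.toFinite (bondsIn 0 (s'.Ω 1)ᶜ)).toFinset
                (Set.toFinite (bondsIn 1 (s'.Ω 1)ᶜ)).toFinset y, v))) 0).2))) * h v ∂(Measure.pi fun _ : {c : PBond (F.P p.K) 1 // c ∉ (Set.toFinite (bondsIn 1 (s'.Ω 1)ᶜ)).toFinset} =>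
            (HaarData.haar : Measure (SU N)))) :
    slotsTOfRecord F N θ.ν θ.τ9 (EOfRecord₁₃ F N θ.toStage13Params) (wOfRecord₉ F N θ.toStage9Params) θ.ppSel p (gOfRecord₁₃ F N θ.toStage13Params p) 1 s' = 0 ∨
      ∀ᵐ V' ∂fieldMeasure (F.P p.K) 1 (SU N),
        chiSeqOfRecord F N θ.ν θ.τ9.M (gOfRecord₁₃ F N θ.toStage13Params p) p.K 1 s' V' ≠ 0 →
          slotsTOfRecord F N θ.ν θ.τ9 (EOfRecord₁₃ F N θ.toStage13Params) (wOfRecord₉ F N θ.toStage9Params) θ.ppSel p (gOfRecord₁₃ F N θ.toStage13Params p) 1 s' V' =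
            sect2Slot F N (FluctV N) p.K (settingOfRecord₁₃ F N θ.toStage13Params p) (θ.rzAt p s') (WtOfRecord₁₃H F N θ p s') s' u₁ e₁
              (UbgOfRecord₁₃CoP F N θ.toStage13Params p 1 s') V' := by
  have hk : 0 + 1 ≤ (F.P p.K).m + (F.P p.K).K := by show 0 + 1 ≤ F.m + p.K; omega
  -- the graph `w(s′)·χ_0·ρ₀ = w(s′)·ρ₀` is `dU`-integrable under the core provisos
  have hG := hG_at_record₁₃_of_provisos θ h p hK s'
  have h1 : (fun U => wOfRecord₉ F N θ.toStage9Params p (gOfRecord₁₃ F N θ.toStage13Params p) 0 s' U ((avOfRecord F N p.K 0).avg U) *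
        slotsOfRecord F N θ.ν θ.τ9 (EOfRecord₁₃ F N θ.toStage13Params) (wOfRecord₉ F N θ.toStage9Params) θ.ppSel p (gOfRecord₁₃ F N θ.toStage13Params p) 0 s'.init U) =
      fun U => wOfRecord₉ F N θ.toStage9Params p (gOfRecord₁₃ F N θ.toStage13Params p) 0 s' U ((avOfRecord F N p.K 0).avg U) *
        (chiSeqOfRecord F N θ.ν θ.τ9.M (gOfRecord₁₃ F N θ.toStage13Params p) p.K 0 s'.init U *
          slotsOfRecord F N θ.ν θ.τ9 (EOfRecord₁₃ F N θ.toStage13Params) (wOfRecord₉ F N θ.toStage9Params) θ.ppSel p (gOfRecord₁₃ F N θ.toStage13Params p) 0 s'.init U) := by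
    funext U; rw [chiSeqOfRecord_zero, one_mul]
  rw [← h1] at hG
  -- the intrinsic reading at the first step is measurable and nonnegative (`admSOfRecord_zero`, `𝐓_0 = 1`)
  have hW := WtOfRecord₁₃H_laws h.zhLaws p s'
  have hmem : (fun _ => (∅ : Set (Site (F.P p.K) 0))) ∈ admSOfRecord F θ.ν θ.τ9.M (gOfRecord₁₃ F N θ.toStage13Params p) p.K 0 s'.init := by
    rw [admSOfRecord_zero, Finset.mem_singleton]
  have hRm := measurable_intrinsicReading_of_hgm θ.ν θ.τ9.M (gOfRecord₁₃ F N θ.toStage13Params p) p (hdec := hdec) (hdec' := hdec') s' (WtOfRecord₁₃H F N θ p s')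
      (sect2Operand F N (FluctV N) p.K (settingOfRecord₁₃ F N θ.toStage13Params p) (θ.rzAt p s') s' u₁ e₁
                  (UbgOfRecord₁₃CoP F N θ.toStage13Params p 1 s')) (hgm_at_record₁₃_of_rows θ p (hdec := hdec) (hdec' := hdec') s' u₁ e₁ hζm hqm' hΦm) _ hmem
  have hR0 : ∀ z : ((↥(Set.toFinite (bondsIn 0 (s'.Ω 1)ᶜ)).toFinset → SU N) × ({c : PBond (F.P p.K) 1 // c ∉ (Set.toFinite (bondsIn 1 (s'.Ω 1)ᶜ)).toFinset} → SU N)), 0 ≤ ∑ Y ∈ (Set.toFinite {Y : Set (Site (F.P p.K) 0) | Y ∈ SClassOfRecord F θ.ν (gOfRecord₁₃ F N θ.toStage13Params p) p.K 1 ∧ Y ⊆ s'.Ω 1 ∩ (s'.Λ 1)ᶜ}).toFinset,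
            zetaOp (genDataOfRecord F N (FluctV N) θ.ν θ.τ9.M (gOfRecord₁₃ F N θ.toStage13Params p) p.K (WtOfRecord₁₃H F N θ p s') s' (Function.update (fun _ => ∅) 1 Y) 0).ζ
              (aOp 0 (genDataOfRecord F N (FluctV N) θ.ν θ.τ9.M (gOfRecord₁₃ F N θ.toStage13Params p) p.K (WtOfRecord₁₃H F N θ p s') s' (Function.update (fun _ => ∅) 1 Y) 0).sA
                (genDataOfRecord F N (FluctV N) θ.ν θ.τ9.M (gOfRecord₁₃ F N θ.toStage13Params p) p.K (WtOfRecord₁₃H F N θ p s') s' (Function.update (fun _ => ∅) 1 Y) 0).w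
                (fun ω => (sect2Operand F N (FluctV N) p.K (settingOfRecord₁₃ F N θ.toStage13Params p) (θ.rzAt p s') s' u₁ e₁
                    (UbgOfRecord₁₃CoP F N θ.toStage13Params p 1 s')) (Function.update (fun _ => ∅) 1 Y, fun j => (ω j).2) (fun j => (ω j).1)))
              (Function.update (baseCfg 1 ((MeasurableEquiv.piEquivPiSubtypeProd (fun _ : PBond (F.P p.K) 1 => SU N)
                (· ∈ (Set.toFinite (bondsIn 1 (s'.Ω 1)ᶜ)).toFinset)).symm (avgRestrOfRecord F N p.K 0 (Set.toFinite (bondsIn 0 (s'.Ω 1)ᶜ)).toFinset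
                  (Set.toFinite (bondsIn 1 (s'.Ω 1)ᶜ)).toFinset z.1, z.2))) 0
              (Function.updateFinset ((baseCfg (V := FluctV N) 1 ((MeasurableEquiv.piEquivPiSubtypeProd (fun _ : PBond (F.P p.K) 1 => SU N)
                (· ∈ (Set.toFinite (bondsIn 1 (s'.Ω 1)ᶜ)).toFinset)).symm (avgRestrOfRecord F N p.K 0 (Set.toFinite (bondsIn 0 (s'.Ω 1)ᶜ)).toFinset
                  (Set.toFinite (bondsIn 1 (s'.Ω 1)ᶜ)).toFinset z.1, z.2))) 0).1 (Set.toFinite (bondsIn 0 (s'.Ω 1)ᶜ)).toFinset z.1,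
                ((baseCfg (V := FluctV N) 1 ((MeasurableEquiv.piEquivPiSubtypeProd (fun _ : PBond (F.P p.K) 1 => SU N)
                (· ∈ (Set.toFinite (bondsIn 1 (s'.Ω 1)ᶜ)).toFinset)).symm (avgRestrOfRecord F N p.K 0 (Set.toFinite (bondsIn 0 (s'.Ω 1)ᶜ)).toFinset
                  (Set.toFinite (bondsIn 1 (s'.Ω 1)ᶜ)).toFinset z.1, z.2))) 0).2)) := fun z =>
    Finset.sum_nonneg fun Y _ => by
      rw [zetaOp_apply]
      exact mul_nonneg ((genDataOfRecord_laws F N (FluctV N) θ.ν θ.τ9.M (gOfRecord₁₃ F N θ.toStage13Params p) p.K hW s' (Function.update (fun _ => ∅) 1 Y) 0).zeta_nonneg _)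
        (aOp_nonneg 0 _ (genDataOfRecord_laws F N (FluctV N) θ.ν θ.τ9.M (gOfRecord₁₃ F N θ.toStage13Params p) p.K hW s' (Function.update (fun _ => ∅) 1 Y) 0).w_nonneg
          (fun ω => (sect2Operand_pos p.K _ _ s' u₁ e₁ _ (Function.update (fun _ => ∅) 1 Y, fun j => (ω j).2) (fun j => (ω j).1)).le) _)
  exact slotsTOfRecord₁₃H_one_O3_of_condExpRho_of_provisos θ h p hK (hdec := hdec) (hdec' := hdec') s' u₁ e₁ hζ0m hqm hζm hqm' hΦm
    (condExp_identity_of_fibrewise_of_nonneg θ.ν θ.τ9.M (gOfRecord₁₃ F N θ.toStage13Params p) p (hdec := hdec) (hdec' := hdec') hk s' hG hR0 hRm hfib)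

end FirstStep

end Summit.QuantumFields.YangMills.Theorems.BalabanUVNodesN11O3OfFibrewiseIdentityAtRecord13

end
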